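import Summits.QuantumAdvantage.QuantumAdvantage.Theorems.CharDialBlockDialE
import HarnessLib

/-!
# The null dial, part A: the ZERO-SUM WINDOW piece engine and ★★★ `nullDial_hard` (decomp-qadv lens-6 g18 «NullDial», tree part 31A)

THE FOURTH W-AWARE DIAL.  The block dial (parts 30M–30Q, `BlockDial.blockDial_hard`) re-sets CONSTANT `p`-blocks on which every cut's form mod `p`
is constant: the form moves by `p·λ = 0`, the weight by `p ≢ 0 (mod 3)`.  The present engine DECOUPLES the window length from the modulus: along
`N` separated WINDOWS `[s k, s k + ℓ)` of ANY length `ℓ ≢ 0 (mod 3)` on which every cut's coefficient vector has ZERO SUM in `ℤ/p`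
(`∑_{i ∈ window} a_g i = 0`; constant `p`-blocks are the special case `ℓ = p`), re-setting a constant window `0^ℓ ↔ 1^ℓ` freezes every form
(`form_bset_null`) and moves the walk by `ℓ ≢ 0 (mod 3)`; the walk bookkeeping of part 30M (`bset`, `walkExp_bset`, `live_iff`, `sel`, `kap`),
the tiling of part 30O (`Bset`, `mix`, `sum_card_Bset`) and the tail of part 30P (`card_few_const_le_half`) are cited BY NAME with block length
`ℓ` (they never mention the modulus).  New here: the zero-sum form lemmas, the strategy-generic game identity `ringWinU_bset_gen`, the
sub-family transport `card_Bset_le_gen`, ★ `nullPiece_hard`, ★★★ `nullDial_hard` (constants `θ, N₁` uniform in `ℓ` and `p`), and the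
consistency corollary `blockDial_of_nullDial` (constant `p`-blocks are zero-sum windows).
Supports item stmt-QuantumAdvantage-32604 (`CharDial.WalkHardFJLinOdd`); source: pub annex g18/OrbitDial38.lean §38a–§38c (sha256 0bc87d36…), namespace
`…Theses.OrbitDial.NullDial`, statements and proofs verbatim (Prop-free).
-/

set_option autoImplicit false

namespace Summit.QuantumAdvantage.AdviceFreeQNC0.JLinPeel.NullDial

open Finset
open Summit.QuantumAdvantage.AdviceFreeQNC0
open Summit.QuantumAdvantage.AdviceFreeQNC0.JLinPeel.BlockDial
open Literature.Computability.MetaComplexity Literature.Computability.MetaComplexity.Smolensky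

section NullPiece
variable {n N : ℕ} {p ℓ : ℕ} {s : Fin N → ℕ}

/-! #### forms are constant along a zero-sum window piece -/

/-- a coefficient vector with ZERO SUM on window `k` contributes `0` over that window at every piece point (the window is constant there). -/
theorem sum_blk_bset_eq_zero_of_null (h : ((∀ k k', k < k' → s k + ℓ ≤ s k') ∧ (∀ k, s k + ℓ ≤ n))) (a : Fin n → ZMod p) {k : Fin N}
    (hnull : ∑ i ∈ blk ℓ s k, a i = 0) (u : Fin n → Bool) (w : Fin N → Bool) :
    (∑ i ∈ blk ℓ s k, (if bset ℓ s u w i = true then a i else 0)) = 0 := by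
  rw [Finset.sum_congr rfl fun i hi => by rw [bset_of_inBlk h u w (mem_blk.mp hi)]]
  cases hw : w k
  · simp
  · simpa using hnull

/-- **the form of a cut whose coefficient vector is zero-sum on every window is CONSTANT along the piece.** -/
theorem form_bset_null (h : ((∀ k k', k < k' → s k + ℓ ≤ s k') ∧ (∀ k, s k + ℓ ≤ n))) (D : JLinPeel.JLinData p n) (g : Fin (n + 1))
    (hnull : ∀ k : Fin N, ∑ i ∈ blk ℓ s k, D.a g i = 0) (u : Fin n → Bool) (v v' : Fin N → Bool) :
    D.form g (bset ℓ s u v) = D.form g (bset ℓ s u v') := by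
  unfold JLinPeel.JLinData.form
  have split := fun w : Fin N → Bool => sum_split h (fun i => if bset ℓ s u w i = true then D.a g i else 0)
  rw [split v, split v']
  congr 1
  · refine Finset.sum_congr rfl fun i hi => ?_
    rw [bset_of_not_inBlk u v (not_inBlk_of_mem_sdiff hi), bset_of_not_inBlk u v' (not_inBlk_of_mem_sdiff hi)]
  · refine Finset.sum_congr rfl fun k _ => ?_
    rw [sum_blk_bset_eq_zero_of_null h (D.a g) (hnull k) u v, sum_blk_bset_eq_zero_of_null h (D.a g) (hnull k) u v']

/-- along the piece a zero-sum cut's answer depends on `v` only through the windows meeting its junta. -/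
theorem strat_bset_eq_null (h : ((∀ k k', k < k' → s k + ℓ ≤ s k') ∧ (∀ k, s k + ℓ ≤ n))) (D : JLinPeel.JLinData p n) (g : Fin (n + 1))
    (hnull : ∀ k : Fin N, ∑ i ∈ blk ℓ s k, D.a g i = 0) (u : Fin n → Bool) {v v' : Fin N → Bool}
    (hvv : ∀ k : Fin N, (∃ i ∈ D.J g, (s k ≤ i.val ∧ i.val < s k + ℓ)) → v k = v' k) :
    D.strat g (bset ℓ s u v) = D.strat g (bset ℓ s u v') := by
  have hJ : ∀ i ∈ D.J g, bset ℓ s u v i = bset ℓ s u v' i := by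
    intro i hi
    by_cases hk : ∃ k, (s k ≤ i.val ∧ i.val < s k + ℓ)
    · obtain ⟨k, hk⟩ := hk
      rw [bset_of_inBlk h u v hk, bset_of_inBlk h u v' hk, hvv k ⟨i, hi, hk⟩]
    · rw [not_exists] at hk
      rw [bset_of_not_inBlk u v hk, bset_of_not_inBlk u v' hk]
  show D.h g (bset ℓ s u v) (D.form g (bset ℓ s u v)) = D.h g (bset ℓ s u v') (D.form g (bset ℓ s u v'))
  rw [form_bset_null h D g hnull u v v', D.hJ g _ _ hJ]

/-- **degree of a piece-game bell** (zero-sum windows): junta `≤ L` ⇒ the bell `(g, ε)` has degree `≤ L + 1` in the window bits. -/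
theorem hasDeg_bell_null (h : ((∀ k k', k < k' → s k + ℓ ≤ s k') ∧ (∀ k, s k + ℓ ≤ n))) (D : JLinPeel.JLinData p n) (g : Fin (n + 1)) (ε : Bool)
    {L d : ℕ} (hJ : (D.J g).card ≤ L) (hd : L + 1 ≤ d) (hnull : ∀ k : Fin N, ∑ i ∈ blk ℓ s k, D.a g i = 0) (u : Fin n → Bool) :
    HasDeg (fun v : Fin N → Bool => D.strat g (bset ℓ s u v) && (ε == sel ℓ s g.val v)) d := by
  classical
  refine hasDeg_of_dependsOn_blk ((univ.filter fun k : Fin N => ∃ i ∈ D.J g, (s k ≤ i.val ∧ i.val < s k + ℓ)) ∪ strad ℓ s g.val) ?_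
    fun v v' hvv => ?_
  · calc ((univ.filter fun k : Fin N => ∃ i ∈ D.J g, (s k ≤ i.val ∧ i.val < s k + ℓ)) ∪ strad ℓ s g.val).card
        ≤ (univ.filter fun k : Fin N => ∃ i ∈ D.J g, (s k ≤ i.val ∧ i.val < s k + ℓ)).card + (strad ℓ s g.val).card :=
          Finset.card_union_le _ _
      _ ≤ L + 1 := add_le_add (le_trans (card_blkMeet_le h (D.J g)) hJ) (card_strad_le_one h g.val)
      _ ≤ d := hd
  · have h1 : D.strat g (bset ℓ s u v) = D.strat g (bset ℓ s u v') :=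
      strat_bset_eq_null h D g hnull u fun k hk => hvv k (Finset.mem_union_left _ (mem_filter.mpr ⟨mem_univ _, hk⟩))
    have h2 : sel ℓ s g.val v = sel ℓ s g.val v' := sel_congr g.val fun k hk => hvv k (Finset.mem_union_right _ hk)
    rw [h1, h2]

/-! #### the piece game is a generalised-bell walk game — for ANY strategy (the game identity never looks at the forms) -/

/-- the trivial full-junta presentation of an arbitrary strategy `σ` (used only to cite `BlockDial.ringWinU_bset` by name). -/
def presOf (ℓ : ℕ) (σ : Fin (n + 1) → (Fin n → Bool) → Bool) : JLinPeel.JLinData ℓ n where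
  J := fun _ => univ
  a := fun _ _ => 0
  h := fun g u _ => σ g u
  hJ := fun g u v huv _ => by rw [show u = v from funext fun i => huv i (mem_univ _)]

/-- it presents `σ`. -/
theorem presOf_strat (ℓ : ℕ) (σ : Fin (n + 1) → (Fin n → Bool) → Bool) : (presOf ℓ σ).strat = σ := rfl

/-- **the game identity for an arbitrary strategy**: the walk game at the piece point `bset u v` is the generalised-bell game on `v` with two
straddle-conditioned bells per cut (pattern position `qcut g`, phases `kap … ff / tt`) — `BlockDial.ringWinU_bset` by name at the trivial
presentation. -/
theorem ringWinU_bset_gen (h : ((∀ k k', k < k' → s k + ℓ ≤ s k') ∧ (∀ k, s k + ℓ ≤ n))) (hℓ3 : ℓ % 3 = 1 ∨ ℓ % 3 = 2) (c : ℕ)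
    (σ : Fin (n + 1) → (Fin n → Bool) → Bool) (u : Fin n → Bool) (v : Fin N → Bool) :
    ringWinU c σ (bset ℓ s u v)
      = AffBells23.ringWinGen (fun b => qcut ℓ s (bellEquiv n b).1.val) (fun b => kap ℓ s c u (bellEquiv n b).1.val (bellEquiv n b).2)
          (fun b w => σ (bellEquiv n b).1 (bset ℓ s u w) && ((bellEquiv n b).2 == sel ℓ s (bellEquiv n b).1.val w)) v := by
  have e := ringWinU_bset h hℓ3 c (presOf ℓ σ) u v
  rw [presOf_strat] at e
  exact e

/-- ★ **THE NULL-PIECE ENGINE.**  There are `θ < 1` and `N₀` — uniform in the window length and the modulus — such that along EVERY piece of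
`N ≥ N₀` separated windows of a length `ℓ ≢ 0 (mod 3)` on which every cut's coefficient vector mod `p` is ZERO-SUM, a junta-`≤ L` ⊕ linear-form
strategy with `(L+1)² ≤ N` wins on at most `θ·2^N` of the `2^N` piece points.  No rank, sparsity, primality or constancy hypothesis. -/
theorem nullPiece_hard :
    ∃ θ : ℝ, θ < 1 ∧ ∃ N₀ : ℕ, ∀ (ℓ : ℕ), (ℓ % 3 = 1 ∨ ℓ % 3 = 2) → ∀ (p n N : ℕ) (s : Fin N → ℕ),
      ((∀ k k', k < k' → s k + ℓ ≤ s k') ∧ (∀ k, s k + ℓ ≤ n)) → N₀ ≤ N →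
      ∀ (L : ℕ), (L + 1) * (L + 1) ≤ N → ∀ (c : ℕ) (D : JLinPeel.JLinData p n),
        (∀ g, (D.J g).card ≤ L) → (∀ g (k : Fin N), ∑ i ∈ blk ℓ s k, D.a g i = 0) →
        ∀ u : Fin n → Bool,
          ((univ.filter fun v : Fin N → Bool => ringWinU c D.strat (bset ℓ s u v) = true).card : ℝ) ≤ θ * (2 : ℝ) ^ N := by
  obtain ⟨θ, hθ, n₀, hgen⟩ := AffBells23.walkHardGenSqrt
  refine ⟨θ, hθ, n₀, fun ℓ hℓ3 p n N s hs hN L hL c D hJ hnull u => ?_⟩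
  have hdeg : ∀ b : Fin ((n + 1) * 2), HasDeg (fun w : Fin N → Bool =>
      D.strat (bellEquiv n b).1 (bset ℓ s u w) && ((bellEquiv n b).2 == sel ℓ s (bellEquiv n b).1.val w)) (Nat.sqrt N) :=
    fun b => hasDeg_bell_null hs D _ _ (hJ _) (Nat.le_sqrt.mpr hL) (hnull _) u
  have hb := hgen N hN ((n + 1) * 2) (fun b => qcut ℓ s (bellEquiv n b).1.val)
    (fun b => kap ℓ s c u (bellEquiv n b).1.val (bellEquiv n b).2) _ hdeg
  have hset : (univ.filter fun v : Fin N → Bool => ringWinU c D.strat (bset ℓ s u v) = true)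
      = univ.filter fun v : Fin N → Bool => AffBells23.ringWinGen (fun b => qcut ℓ s (bellEquiv n b).1.val)
          (fun b => kap ℓ s c u (bellEquiv n b).1.val (bellEquiv n b).2)
          (fun b w => D.strat (bellEquiv n b).1 (bset ℓ s u w) && ((bellEquiv n b).2 == sel ℓ s (bellEquiv n b).1.val w)) v
          = true := by
    refine Finset.filter_congr fun v _ => ?_
    rw [ringWinU_bset_gen hs hℓ3 c D.strat u v]
  rw [hset]
  exact hb

end NullPiece

section NullAssembly
open Classical
variable {n M : ℕ} {ℓ : ℕ} {S : Fin M → ℕ}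

/-! #### the global assembly: a strategy-generic transport of piece bounds to the cube, then ★★★ `nullDial_hard` -/

/-- a sub-family of a separated window family (re-indexed increasingly) is separated. -/
theorem sep_sub (h : ((∀ k k', k < k' → S k + ℓ ≤ S k') ∧ (∀ k, S k + ℓ ≤ n))) {N : ℕ} {e : Fin N → Fin M} (he : StrictMono e) :
    ((∀ k k' : Fin N, k < k' → S (e k) + ℓ ≤ S (e k')) ∧ (∀ k : Fin N, S (e k) + ℓ ≤ n)) :=
  ⟨fun _ _ hkk => h.1 _ _ (he hkk), fun _ => h.2 _⟩

/-- **piece bounds transported to the cube, for any property `P` of inputs**: if along every increasingly re-indexed sub-family of `> T`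
windows the piece through every input has at most `θ·2^N` parameters with property `P`, then so does the adaptive piece `Bset u ·` through
every `u` with `> T` constant windows (`Subcube.card_filter_merge_le` on the window cube, free windows re-indexed by `Subcube.emb`). -/
theorem card_Bset_le_gen (h : ((∀ k k', k < k' → S k + ℓ ≤ S k') ∧ (∀ k, S k + ℓ ≤ n))) {θ : ℝ} {T : ℕ}
    (P : (Fin n → Bool) → Prop) [DecidablePred P]
    (hpiece : ∀ (N : ℕ) (e : Fin N → Fin M), StrictMono e → T < N →
      ∀ u : Fin n → Bool, ((univ.filter fun v : Fin N → Bool => P (bset ℓ (fun j => S (e j)) u v)).card : ℝ) ≤ θ * (2 : ℝ) ^ N)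
    (u : Fin n → Bool) (hT : T < (cblk ℓ S u).card) :
    ((univ.filter fun w : Fin M → Bool => P (Bset ℓ S u w)).card : ℝ) ≤ θ * (2 : ℝ) ^ M := by
  set W : Finset (Fin M) := univ \ cblk ℓ S u with hW
  let a : Fin M → Bool := fun _ => false
  let s' : Fin (M - W.card) → ℕ := fun j => S (Subcube.emb W j)
  have hWc : W.card + (cblk ℓ S u).card = M := by
    rw [hW, Finset.card_sdiff_add_card_eq_card (subset_univ _), card_univ, Fintype.card_fin]
  have hMW : M - W.card = (cblk ℓ S u).card := by omega
  have hmemF : ∀ {k : Fin M}, k ∉ W ↔ (∀ x₁ x₂ : Fin n, (S k ≤ x₁.val ∧ x₁.val < S k + ℓ) → (S k ≤ x₂.val ∧ x₂.val < S k + ℓ) → u x₁ = u x₂) := by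
    intro k
    rw [hW, mem_sdiff, cblk, mem_filter]
    simp only [Finset.mem_univ, true_and, not_not]
  have hs' : ((∀ k k', k < k' → s' k + ℓ ≤ s' k') ∧ (∀ k, s' k + ℓ ≤ n)) := sep_sub h (Subcube.emb_strictMono W)
  have hext : ∀ v : Fin (M - W.card) → Bool, Bset ℓ S u (Subcube.ext W a v) = bset ℓ s' u v := by
    intro v
    funext i
    by_cases hx : ∃ k, (S k ≤ i.val ∧ i.val < S k + ℓ) ∧ (∀ x₁ x₂ : Fin n, (S k ≤ x₁.val ∧ x₁.val < S k + ℓ) → (S k ≤ x₂.val ∧ x₂.val < S k + ℓ) → u x₁ = u x₂)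
    · obtain ⟨k, hki, hc⟩ := hx
      have hkW : k ∉ W := hmemF.mpr hc
      have hj : (s' (Subcube.idx W k hkW) ≤ i.val ∧ i.val < s' (Subcube.idx W k hkW) + ℓ) := by
        show S (Subcube.emb W (Subcube.idx W k hkW)) ≤ i.val ∧ i.val < S (Subcube.emb W (Subcube.idx W k hkW)) + ℓ
        rw [Subcube.emb_idx]
        exact hki
      rw [Bset_of_const h u _ hki hc, bset_of_inBlk hs' u v hj]
      unfold Subcube.ext
      rw [dif_neg hkW]
    · rw [Bset_of_not u _ hx, bset_of_not_inBlk u v fun j hj => hx ⟨Subcube.emb W j, hj, hmemF.mp (Subcube.emb_not_mem W j)⟩]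
  have hdepW : ∀ w : Fin M → Bool, Bset ℓ S u (AffBells22.subcubeMerge W a w) = Bset ℓ S u w := by
    intro w
    funext i
    unfold Bset
    by_cases hx : ∃ k, (S k ≤ i.val ∧ i.val < S k + ℓ) ∧ (∀ x₁ x₂ : Fin n, (S k ≤ x₁.val ∧ x₁.val < S k + ℓ) → (S k ≤ x₂.val ∧ x₂.val < S k + ℓ) → u x₁ = u x₂)
    · rw [dif_pos hx, dif_pos hx]
      unfold AffBells22.subcubeMerge
      rw [if_neg (hmemF.mpr hx.choose_spec.2)]
    · rw [dif_neg hx, dif_neg hx]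
  have e1 : (univ.filter fun w : Fin M → Bool => P (Bset ℓ S u w))
      = univ.filter fun w : Fin M → Bool => P (Bset ℓ S u (AffBells22.subcubeMerge W a w)) := by
    refine Finset.filter_congr fun w _ => ?_
    rw [hdepW]
  have e2 : (univ.filter fun v : Fin (M - W.card) → Bool => P (Bset ℓ S u (Subcube.ext W a v)))
      = univ.filter fun v : Fin (M - W.card) → Bool => P (bset ℓ s' u v) := by
    refine Finset.filter_congr fun v _ => ?_
    rw [hext]
  have hmul := Subcube.card_filter_merge_le W a (fun w : Fin M → Bool => P (Bset ℓ S u w))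
  rw [← e1, e2] at hmul
  have hp' := hpiece (M - W.card) (Subcube.emb W) (Subcube.emb_strictMono W) (by rw [hMW]; exact hT) u
  have hpow : (2 : ℝ) ^ W.card * (2 : ℝ) ^ (M - W.card) = (2 : ℝ) ^ M := by
    rw [← pow_add, Subcube.card_add_sub]
  calc ((univ.filter fun w : Fin M → Bool => P (Bset ℓ S u w)).card : ℝ)
      ≤ (2 : ℝ) ^ W.card * ((univ.filter fun v : Fin (M - W.card) → Bool => P (bset ℓ s' u v)).card : ℝ) := by
        exact_mod_cast hmul
    _ ≤ (2 : ℝ) ^ W.card * (θ * (2 : ℝ) ^ (M - W.card)) := by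
        exact mul_le_mul_of_nonneg_left hp' (by positivity)
    _ = θ * (2 : ℝ) ^ M := by rw [← hpow]; ring

/-- **the generic W-aware dial assembly**: a piece bound `θ` valid through every input with `> T` constant windows of a family of
`M ≥ 2^ℓ·(T+1)` separated `ℓ`-windows (`ℓ ≥ 1`, `θ ≤ 1`) gives the global bound `((1+θ)/2)·2ⁿ` (tiling `sum_card_Bset` + tail
`card_few_const_le_half`, both of part 30O/30P by name with block length `ℓ`). -/
theorem dial_of_pieces (h : ((∀ k k', k < k' → S k + ℓ ≤ S k') ∧ (∀ k, S k + ℓ ≤ n))) (hℓ : 1 ≤ ℓ) {θ : ℝ} (hθ1 : θ ≤ 1) {T : ℕ}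
    (hMT : 2 ^ ℓ * (T + 1) ≤ M) (P : (Fin n → Bool) → Prop) [DecidablePred P]
    (hpiece : ∀ (N : ℕ) (e : Fin N → Fin M), StrictMono e → T < N →
      ∀ u : Fin n → Bool, ((univ.filter fun v : Fin N → Bool => P (bset ℓ (fun j => S (e j)) u v)).card : ℝ) ≤ θ * (2 : ℝ) ^ N) :
    ((univ.filter fun u : Fin n → Bool => P u).card : ℝ) ≤ (1 + θ) / 2 * (2 : ℝ) ^ n := by
  have htile := sum_card_Bset h hℓ P
  have hbad_le := card_few_const_le_half h hℓ T hMT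
  have hper : ∀ u : Fin n → Bool,
      ((univ.filter fun w : Fin M → Bool => P (Bset ℓ S u w)).card : ℝ)
        ≤ (if (cblk ℓ S u).card ≤ T then (2 : ℝ) ^ M else θ * (2 : ℝ) ^ M) := by
    intro u
    by_cases hu : (cblk ℓ S u).card ≤ T
    · rw [if_pos hu]
      have hle : (univ.filter fun w : Fin M → Bool => P (Bset ℓ S u w)).card ≤ 2 ^ M := by
        calc _ ≤ (univ : Finset (Fin M → Bool)).card := card_le_card (filter_subset _ _)
          _ = 2 ^ M := by rw [card_univ, Fintype.card_fun, Fintype.card_bool, Fintype.card_fin]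
      exact_mod_cast hle
    · rw [if_neg hu]
      exact card_Bset_le_gen h P hpiece u (by omega)
  have hsum : (((2 ^ M * (univ.filter fun u : Fin n → Bool => P u).card : ℕ)) : ℝ)
      ≤ ∑ u : Fin n → Bool, (if (cblk ℓ S u).card ≤ T then (2 : ℝ) ^ M else θ * (2 : ℝ) ^ M) := by
    rw [← htile]
    push_cast
    exact Finset.sum_le_sum fun u _ => hper u
  rw [Finset.sum_ite, Finset.sum_const, Finset.sum_const, nsmul_eq_mul, nsmul_eq_mul] at hsum
  push_cast at hsum
  have htot : ((univ.filter fun u : Fin n → Bool => (cblk ℓ S u).card ≤ T).card : ℝ)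
      + ((univ.filter fun u : Fin n → Bool => ¬ (cblk ℓ S u).card ≤ T).card : ℝ) = (2 : ℝ) ^ n := by
    have e := Finset.card_filter_add_card_filter_not (s := (univ : Finset (Fin n → Bool)))
      (fun u : Fin n → Bool => (cblk ℓ S u).card ≤ T)
    rw [card_univ, Fintype.card_fun, Fintype.card_bool, Fintype.card_fin] at e
    exact_mod_cast e
  have h2M : (0 : ℝ) < (2 : ℝ) ^ M := by positivity
  set B : ℝ := ((univ.filter fun u : Fin n → Bool => (cblk ℓ S u).card ≤ T).card : ℝ) with hB
  set G : ℝ := ((univ.filter fun u : Fin n → Bool => ¬ (cblk ℓ S u).card ≤ T).card : ℝ) with hG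
  set Wn : ℝ := ((univ.filter fun u : Fin n → Bool => P u).card : ℝ) with hWn
  have hsum' : (2 : ℝ) ^ M * Wn ≤ (2 : ℝ) ^ M * (B + θ * G) := by
    have e : B * (2 : ℝ) ^ M + G * (θ * (2 : ℝ) ^ M) = (2 : ℝ) ^ M * (B + θ * G) := by ring
    rw [← e]
    exact hsum
  have hW : Wn ≤ B + θ * G := le_of_mul_le_mul_left hsum' h2M
  have hGe : G = (2 : ℝ) ^ n - B := by linarith
  have h1θ : 0 ≤ 1 - θ := by linarith
  have hprod : (1 - θ) * B ≤ (1 - θ) * ((2 : ℝ) ^ n / 2) := mul_le_mul_of_nonneg_left hbad_le h1θ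
  rw [hGe] at hW
  nlinarith [hW, hprod]

/-- ★★★ **THE NULL DIAL `nullDial_hard`.**  There are `θ < 1` and `N₁` — uniform in `ℓ` and `p` — such that: for every window length
`ℓ ≢ 0 (mod 3)`, whenever `M ≥ 2^ℓ·(N₁+1)` and `M ≥ 2^ℓ·((L+1)²+1)` pairwise separated `ℓ`-windows fit into `{0,…,n−1}`, every junta ⊕
linear-form strategy mod `p` with juntas of size `≤ L` whose forms are ZERO-SUM ON EACH WINDOW (arbitrary elsewhere, arbitrary tables) wins the
mod-3 walk game with shift `c` on at most `θ·2ⁿ` inputs.  W-AWARE: along a piece the weight moves by multiples of `ℓ`; the forms are frozen. -/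
theorem nullDial_hard :
    ∃ θ : ℝ, θ < 1 ∧ ∃ N₁ : ℕ, ∀ (ℓ : ℕ), (ℓ % 3 = 1 ∨ ℓ % 3 = 2) → ∀ (p n M L : ℕ) (S : Fin M → ℕ),
      ((∀ k k', k < k' → S k + ℓ ≤ S k') ∧ (∀ k, S k + ℓ ≤ n)) →
      2 ^ ℓ * (N₁ + 1) ≤ M → 2 ^ ℓ * ((L + 1) * (L + 1) + 1) ≤ M →
      ∀ (c : ℕ) (D : JLinPeel.JLinData p n), (∀ g, (D.J g).card ≤ L) →
        (∀ g (k : Fin M), ∑ i ∈ blk ℓ S k, D.a g i = 0) →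
        ((univ.filter fun u : Fin n → Bool => ringWinU c D.strat u = true).card : ℝ) ≤ θ * (2 : ℝ) ^ n := by
  obtain ⟨θ, hθ, N₀, hpiece⟩ := nullPiece_hard
  refine ⟨(1 + θ) / 2, by linarith, N₀, ?_⟩
  intro ℓ hℓ3 p n M L S h hM₁ hM₂ c D hJ hnull
  have hℓ1 : 1 ≤ ℓ := by omega
  set T : ℕ := max N₀ ((L + 1) * (L + 1)) with hT
  have hMT : 2 ^ ℓ * (T + 1) ≤ M := by
    rcases le_total N₀ ((L + 1) * (L + 1)) with hle | hle
    · rw [hT, max_eq_right hle]; exact hM₂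
    · rw [hT, max_eq_left hle]; exact hM₁
  have hTN : N₀ ≤ T := le_max_left _ _
  have hTL : (L + 1) * (L + 1) ≤ T := le_max_right _ _
  refine dial_of_pieces h hℓ1 hθ.le hMT (fun u : Fin n → Bool => ringWinU c D.strat u = true) ?_
  intro N e he hTN' u
  exact hpiece ℓ hℓ3 p n N (fun j => S (e j)) (sep_sub h he) (by omega) L (by omega) c D hJ (fun g j => hnull g (e j)) u

/-! #### consistency: constant `p`-blocks are zero-sum windows, so the block dial is the case `ℓ = p` of the null dial -/

/-- a coefficient vector constant on a separated `p`-block has zero sum on it (`p·λ = 0` in `ℤ/p`). -/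
theorem sum_blk_eq_zero_of_const {p : ℕ} {S : Fin M → ℕ} (h : ((∀ k k', k < k' → S k + p ≤ S k') ∧ (∀ k, S k + p ≤ n)))
    (a : Fin n → ZMod p) (k : Fin M)
    (hconst : ∀ i i' : Fin n, (S k ≤ i.val ∧ i.val < S k + p) → (S k ≤ i'.val ∧ i'.val < S k + p) → a i = a i') :
    ∑ i ∈ blk p S k, a i = 0 := by
  rcases (blk (n := n) p S k).eq_empty_or_nonempty with he | ⟨i₀, hi₀⟩
  · rw [he, Finset.sum_empty]
  · rw [Finset.sum_congr rfl fun i hi => hconst i i₀ (mem_blk.mp hi) (mem_blk.mp hi₀), Finset.sum_const, card_blk h k]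
    simp [nsmul_eq_mul]

-- `blockDial_of_nullDial` (g17's block dial as the constant-window case of the null dial) is omitted at landing: its statement restates the landed
-- `BlockDial.blockDial_hard` (gate dedup, dry-run 08:38Z); the derivation is in the annex §38c.

end NullAssembly

end Summit.QuantumAdvantage.AdviceFreeQNC0.JLinPeel.NullDial
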